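import Summits.AtomisticToContinuum.HydrodynamicLimit.Theses.JParityClosure
import Summits.AtomisticToContinuum.HydrodynamicLimit.Theses.InformationPercolationEngine
import Summits.AtomisticToContinuum.HydrodynamicLimit.Theses.TwoClocks
import Summits.AtomisticToContinuum.HydrodynamicLimit.Theses.LimitCollisionMeasure
import Summits.AtomisticToContinuum.HydrodynamicLimit.Theorems.InformationPercolationEngineChaosClosesEulerEnskogIdentity
import Summits.AtomisticToContinuum.HydrodynamicLimit.Theorems.InformationPercolationEngineChaosClosesEulerCollisionMomentUI
import Summits.AtomisticToContinuum.HydrodynamicLimit.Theorems.InformationPercolationEngineChaosClosesEulerReadout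
import Summits.AtomisticToContinuum.HydrodynamicLimit.Theorems.JParityClosureParityBandClosurePressureValueOfEvenStress
import HarnessLib

/-!
# Line `plain-entropy-finite-n-bf` — crux `JParityClosure.ParityBandClosure` (stmt-AtomisticToContinuum-17608), planner's skeleton v1

THE CRUX (fixed). `ParityBandClosure := OddContactSymmetry → EvenStressEnskog → RateFloor → LocalSecondLaw → DensityCap →
_root_.HydrodynamicLimit` — the closure step of route JParityClosure (the five physics cruxes ⇒ the packing-guarded conjunct).

THE IDEA (card `Ideas/plain-entropy-finite-n-bf.md`, triage r1-1/r1-2/r1-3: pass ×3). Every closure architecture on the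
board feeds the Březina–Feireisl relative energy with the CLAMPED local second law (`LimitCollisionMeasure.LocalSecondLaw`,
stmt-13352, renormalised `Z = clamp a b`) — an item NOT among the five hypotheses — while the route's own PLAIN second law
(`JParityClosure.LocalSecondLaw`, stmt-13081, `Z = id`) stays idle (dead line `Sketch`: `_hL` unused; sister crux 15141, NOTES
§B3).  For the ATHERMAL hard-sphere law (`p = (2/3) Z(ρσ³) ρ e`, `monatomicExcess_p_eq_energy`) the `Z = id` relative-energy
inequality on the `r`-mollified EMPIRICAL fields of one trajectory (finite `N`, no Young measure) has exactly ONE remainder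
that the Bregman density does not dominate: the cross term `∫ ϱ (s − s̃)(u − ũ)·∇θ̃` on cells that are COLD AND FAST.
`coldCrossBound` (PROVED below; AM–GM) prices it pointwise: `(3/2)ϱ a w ≤ √(3a/(2θ̃)) · Bregman`, `a = log(θ̃/θ) ≥ 2` the
coldness — cells of coldness `≤ A` are Grönwall-absorbed with constant `e^{C√A t}`, and the whole use of a temperature floor
collapses to ONE scalar budget on `{a > A}`.  TRIAGE SHARPENING, taken one step further: the Grönwall
`ℰ′ ≤ (C√A + 1)ℰ + C²B_A/4 + err`, `B_A = ∫ϱ a² 1_{a>A}`, needs `e^{(C√A+1)t}·∫B_A → 0` for EVERY `C` (the constant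
depends on the classical solution), so neither the card's `O_P(1)` budget nor bare uniform integrability nor any polynomial
moment of `a` closes it (r1-1); an exponential rate in `A` does, and `B_A ≤ K A² e^{−pA}` follows from a `p`-th INVERSE
TEMPERATURE MOMENT `∫∫ ρ_r (θ̃/θ_r ∨ 1)^p ≤ K`.  That moment is the line's single new physical input `ColdnessMoment`
(stub); it also gives `∫∫ρ_r a ≤ K/p`, the `L¹` entropy bound that pays the `C¹`-approximation of the test `θ̃·cut` by the
smooth tests of 13081 (r1-1, second point).

THE SKELETON = the sister dock (crux 15141, `Cruxes/ChaosClosesEuler/Lines/Sketch.lean` v11) with the clamped law swapped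
out.  LANDED pieces used BY NAME (no stub): the weak readout at the instant `ChaosClosesEulerReadout.stub_readout`
(p119530), `ChaosClosesEulerCollisionMomentUI.stub_collisionMomentUI` (p110597: 13354 ⇒ UI of the quadratic collision
mark), `ChaosClosesEulerEnskogIdentity.stub_empiricalEnskogIdentity` (p107599), the pressure value from `EvenStressEnskog`
`ParityBandClosurePressureValue.stub_pressureValueOfEvenStress` (p136561, this crux's wave 1); inside the reduction the
prover also has `ChaosClosesEulerMassBalanceC1.stub_massBalanceC1` (p133127), `ChaosClosesEulerWeakEquation.stub_weakEquation`
(p108039), `ChaosClosesEulerInitialLayer.stub_initialLayer` (p97752) as theorems.  REGISTERED STUBS (5):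
* `stub_inputs` [EXTERNAL bundle, not this line's work]: `TwoClocks.EnergyCurrentTails` (9235) ∧
  `LimitCollisionMeasure.CollisionTightness` (13354) ∧ `InformationPercolationEngine.CollisionRate` (13481).  NOT 13352.
* `stub_kineticHalf` [INPUT LAYER over the route decl NAMES; DEAD AS TYPED (`Lines/SketchDead.md`, p141493), live verbatim
  once the tenure planner applies R-a/R-b by `--restate` (decl names are kept)]: `OddContactSymmetry → RateFloor →
  DensityCap → 9235 → 13354 → WeakStressIsotropyInBand`.  No stub of THIS line touches 17722/13080.
* `stub_coldnessMoment` [OWN, new physical input, L–XL]: `ColdnessMoment`.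
* `stub_plainEntropyShell` [OWN, LOAD-BEARING, XL deterministic]: `PlainEntropyShellHS` — BF's relative-energy shell for
  FUNCTIONS with the PLAIN entropy inequality + coldness budget + in-band cap + thin frozen cells; template = the landed
  clamped shell `ChaosClosesEulerBF18Shell.stub_bf18Shell` (p136414 + 20 helpers).
* `stub_plainKineticReduction` [OWN, XL− bookkeeping; template = the landed `ChaosClosesEulerKineticReduction.stub_kineticReduction`
  p138091]: `WSI → CPV → CollisionMomentUI → CollisionRate → JParityClosure.LocalSecondLaw (13081, PLAIN) → DensityCap →
  ColdnessMoment → PlainEntropyShellHS → MollifiedCloseTimeAveraged`.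
`ParityBandClosure_of : JParityClosure.ParityBandClosure` is PROVED below from the stubs by pure logic and CONSUMES ALL FIVE
hypotheses (`hL : LocalSecondLaw` included — the first skeleton on this crux in which 13081 is not idle and 13352 absent).

DISPROOF USED (`Cruxes/ParityBandClosure/Disproof.lean`, cycle 1): §1 `not_parityBandClosure_iff` — a proof device, the
conclusion is the route decl by name; §2 — no `_false_without_<H>` can exist (summit-hard); the line nevertheless uses every
`H` (OCS/RF in `stub_kineticHalf`, ESE in the landed pressure value, LSL in (H3') of the reduction, DC in (H7)/(H8) and the
readout); §5 `not_isEntropyCutoff_id` / `total_entropy_balance_not_renormalised` — honoured by NOT feeding `Z = id` to the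
vendored engine: the shell is re-proved for FUNCTIONS (Dirac Young measure = the finite-`N` empirical field, no oscillation
defect; the two-cell toy is a Young-measure phenomenon); §3 vacuity channel unused (`η₀` comes from the stubs' thresholds);
§6 junk audit — `θm = 0` (single-particle cones) gives junk `log 0 = 0`: weight `1` in `ColdnessMoment`, entropy `0` in
13081/(H3'), priced by (H8).  Landed Negative lemmas: `YoungMixingObstruction` (p141493) bears on `stub_kineticHalf` only
(acknowledged dead as typed); `Anatomy` (propositional).  No stub restates the crux, the Statement or a negatives-index entry
(20 entries 2026-08-17; cold-cell items 6610/6612/9236/9238 are singleton-subpopulation statements at shrinking scale — here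
`ρ`-weighted, `N → ∞` before `r → 0`; 14607 is an exponential-currency cubic tail — here `O_P(1)`).
-/

noncomputable section

namespace Summit.AtomisticToContinuum.HydrodynamicLimit.Cruxes.ParityBandClosure.PlainEntropyFiniteNBf

open scoped BigOperators Topology Classical MeasureTheory ENNReal InnerProductSpace
open Filter Set MeasureTheory
open Literature.MathematicalPhysics.KineticTheory
open Literature.Analysis.FluidPDE
open Summit.AtomisticToContinuum.HydrodynamicLimit.Theses

/-! ## §0 The anatomy lemma of the idea (PROVED; from `IdeatorOneSketch.lean`, card A) -/

/-- **Cold-side cross term vs Bregman density.** For a cell of density `ρ ≥ 0`, kinetic temperature `θ`, classical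
temperature `θt`, coldness `a = log(θt/θ) ≥ 2` and velocity mismatch `w = |u − ũ| ≥ 0`, the cross density `(3/2) ρ a w`
is at most `√(3a/(2θt))` times the relative-energy density `(3/2)ρ(θ − θt − θt log(θ/θt)) + ρ w²/2` (AM–GM, equality at
`w = √(3 θt a)`).  The `√a` growth is the whole point: coldness `≤ A` costs a Grönwall constant `e^{C√A t}`, and only
cold-AND-fast cells are left for the budget (H6) of `PlainEntropyShellHS`. [folklore; FeireislNovotny2012 §4 cross term] -/
theorem coldCrossBound (ρ θ θt w : ℝ) (hρ : 0 ≤ ρ) (hθ : 0 < θ) (hθt : 0 < θt)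
    (hcold : θ ≤ θt * Real.exp (-2)) (hw : 0 ≤ w) :
    (3 / 2) * ρ * Real.log (θt / θ) * w ≤
      Real.sqrt (3 * Real.log (θt / θ) / (2 * θt)) *
        ((3 / 2) * ρ * (θ - θt - θt * Real.log (θ / θt)) + ρ * w ^ 2 / 2) := by
  set a := Real.log (θt / θ) with ha_def
  have hquot : Real.exp 2 ≤ θt / θ := by
    rw [le_div_iff₀ hθ]
    have h1 : Real.exp 2 * θ ≤ Real.exp 2 * (θt * Real.exp (-2)) :=
      mul_le_mul_of_nonneg_left hcold (Real.exp_pos 2).le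
    have h2 : Real.exp 2 * (θt * Real.exp (-2)) = θt := by
      rw [mul_comm, mul_assoc, ← Real.exp_add]; norm_num
    linarith
  have ha2 : 2 ≤ a := by
    rw [ha_def, Real.le_log_iff_exp_le (div_pos hθt hθ)]
    exact hquot
  have ha0 : 0 ≤ a := by linarith
  have hlog : Real.log (θ / θt) = -a := by
    rw [ha_def, ← Real.log_inv, inv_div]
  rw [hlog]
  have hB : (3 / 4) * ρ * θt * a + ρ * w ^ 2 / 2 ≤
      (3 / 2) * ρ * (θ - θt - θt * -a) + ρ * w ^ 2 / 2 := by
    have : θt * a / 2 ≤ θ - θt - θt * -a := by nlinarith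
    nlinarith
  set K := Real.sqrt (3 * a / (2 * θt)) with hK
  have hK0 : 0 ≤ K := Real.sqrt_nonneg _
  have hKsq : K ^ 2 = 3 * a / (2 * θt) := by
    rw [hK, Real.sq_sqrt]; positivity
  have hB0 : 0 ≤ (3 / 4) * ρ * θt * a + ρ * w ^ 2 / 2 := by positivity
  have hA0 : 0 ≤ (3 / 2) * ρ * a * w := by positivity
  have hsq : ((3 / 2) * ρ * a * w) ^ 2 ≤ (K * ((3 / 4) * ρ * θt * a + ρ * w ^ 2 / 2)) ^ 2 := by
    have hexp : (K * ((3 / 4) * ρ * θt * a + ρ * w ^ 2 / 2)) ^ 2 =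
        (3 * a / (2 * θt)) * ((3 / 4) * ρ * θt * a + ρ * w ^ 2 / 2) ^ 2 := by
      rw [mul_pow, hKsq]
    rw [hexp]
    have hθt' : (0:ℝ) < 2 * θt := by positivity
    have hrew : 3 * a / (2 * θt) * ((3 / 4) * ρ * θt * a + ρ * w ^ 2 / 2) ^ 2
        = (3 * a * ((3 / 4) * ρ * θt * a + ρ * w ^ 2 / 2) ^ 2) / (2 * θt) := by ring
    rw [hrew, le_div_iff₀ hθt']
    have key : 3 * a * ((3 / 4) * ρ * θt * a + ρ * w ^ 2 / 2) ^ 2 - ((3 / 2) * ρ * a * w) ^ 2 * (2 * θt)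
        = 3 * a * ((3 / 4) * ρ * θt * a - ρ * w ^ 2 / 2) ^ 2 := by ring
    nlinarith [key, mul_nonneg (by norm_num : (0:ℝ) ≤ 3) (mul_nonneg ha0 (sq_nonneg ((3 / 4) * ρ * θt * a - ρ * w ^ 2 / 2)))]
  have hM0 : 0 ≤ K * ((3 / 4) * ρ * θt * a + ρ * w ^ 2 / 2) := mul_nonneg hK0 hB0
  have hmain : (3 / 2) * ρ * a * w ≤ K * ((3 / 4) * ρ * θt * a + ρ * w ^ 2 / 2) :=
    (pow_le_pow_iff_left₀ hA0 hM0 two_ne_zero).mp hsq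
  calc (3 / 2) * ρ * a * w ≤ K * ((3 / 4) * ρ * θt * a + ρ * w ^ 2 / 2) := hmain
    _ ≤ K * ((3 / 2) * ρ * (θ - θt - θt * -a) + ρ * w ^ 2 / 2) :=
        mul_le_mul_of_nonneg_left hB hK0

/-! ## §1 Typed waypoints SHARED with the board (local names; bodies VERBATIM the sister line `Cruxes/ChaosClosesEuler/Lines/Sketch.lean`
v11 / the dead line `Lines/Sketch.lean` of this crux, against which the landed theorems used below were stated) -/

/-- **Uniform integrability of the quadratic collision mark** (sister `CollisionMomentUI`, verbatim): the `K_N`-functional of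
`(1 + |vᵢ|² + |vⱼ|²)·1{|vᵢ|² + |vⱼ|² > L}` is small in probability for large `L`.  Derived from
`LimitCollisionMeasure.CollisionTightness` (13354) by the LANDED `ChaosClosesEulerCollisionMomentUI.stub_collisionMomentUI` (p110597). -/
def CollisionMomentUI : Prop :=
  ∀ (a₀ θ₀ : T3 → ℝ) (u₀ : T3 → V3), Continuous a₀ → Continuous θ₀ → Continuous u₀ →
    (∀ x, 0 < a₀ x) → (∀ x, 0 < θ₀ x) → ∃ σ₀ : ℝ, 0 < σ₀ ∧ ∀ σ : ℝ, 0 < σ → σ < σ₀ →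
    ∀ Φ : (N : ℕ) → HardSphereFlow (Torus.geometry (Fin 3)) (hsDiameter σ N) (N + 1),
    ∀ τ : ℝ, 0 < τ → ∀ η δ : ℝ, 0 < η → 0 < δ → ∃ L : ℝ, ∃ N₀ : ℕ, ∀ N : ℕ, N₀ ≤ N →
    let ε := hsDiameter σ N
    let G : Geometry (Fin 3) T3 := Torus.geometry (Fin 3)
    let γ : Config (N + 1) (Fin 3) T3 → ℝ → Config (N + 1) (Fin 3) T3 := fun z s => (Φ N).flow s z
    let Kc : (Config (N + 1) (Fin 3) T3 → ℝ → Fin (N + 1) → Fin (N + 1) → ℝ) → Config (N + 1) (Fin 3) T3 → ℝ := fun F z =>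
      ε / (N + 1 : ℝ) * ∑ᶠ (s : ℝ) (_ : s ∈ collisionTimes G ε (γ z) ∩ Set.Icc 0 τ),
        ∑ i : Fin (N + 1), ∑ j : Fin (N + 1),
          (if i ≠ j ∧ ‖G.sepVec (γ z s i).1 (γ z s j).1‖ = ε then F z s i j else 0)
    localGibbsLaw σ a₀ u₀ θ₀ N (Φ N)
        {z | η < Kc (fun z s i j => if L < ‖(γ z s i).2‖ ^ 2 + ‖(γ z s j).2‖ ^ 2 then
          1 + ‖(γ z s i).2‖ ^ 2 + ‖(γ z s j).2‖ ^ 2 else 0) z} ≤ ENNReal.ofReal δ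

/-- **Weak isotropy of the local pressure tensor, in band, pre-shock** (sister `WeakStressIsotropyInBand`, verbatim): for
every continuous TRACELESS tensor test field `a(s,x)` and continuous cut-off `g` vanishing on `[η₀,∞)`, the space–time integral
of `g(σ³ρ_r)·a : P_r` (`P_r` the full cone-mollified central second-moment tensor) tends to `0` in probability (`N → ∞` then
`r → 0`).  The card's Θ-algebra (landed p136561) shows this is ALL the flux closure this route needs; in THIS line it is the
output of the input-layer stub `stub_kineticHalf`. -/
def WeakStressIsotropyInBand : Prop :=
  ∃ η₀ : ℝ, 0 < η₀ ∧ ∀ (a₀ θ₀ : T3 → ℝ) (u₀ : T3 → V3), Continuous a₀ → Continuous θ₀ → Continuous u₀ →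
    (∀ x, 0 < a₀ x) → (∀ x, 0 < θ₀ x) → ∃ σ₀ : ℝ, 0 < σ₀ ∧ ∀ σ : ℝ, 0 < σ → σ < σ₀ →
    ∀ (T : ℝ) (ρ θ : ℝ → T3 → ℝ) (u : ℝ → T3 → V3), IsHardSphereEulerSolution σ T ρ u θ →
    ∀ Φ : (N : ℕ) → HardSphereFlow (Torus.geometry (Fin 3)) (hsDiameter σ N) (N + 1),
    TendstoHydroFieldsAt (fun N => localGibbsLaw σ a₀ u₀ θ₀ N (Φ N)) Φ ρ u θ 0 →
    ∀ t ∈ Set.Ico 0 T, ∀ a : Fin 3 → Fin 3 → ℝ × T3 → ℝ, (∀ j k, Continuous (a j k)) →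
    (∀ p, ∑ j : Fin 3, a j j p = 0) →
    ∀ g : ℝ → ℝ, Continuous g → (∀ b, η₀ ≤ b → g b = 0) →
    ∀ η δ : ℝ, 0 < η → 0 < δ → ∃ r₀ : ℝ, 0 < r₀ ∧ ∀ r : ℝ, 0 < r → r < r₀ → ∃ N₀ : ℕ, ∀ N : ℕ, N₀ ≤ N →
    let bx : T3 → T3 → ℝ := fun y x => 3 / (Real.pi * r ^ 3) * max (1 - Torus.euclidDist y x / r) 0
    let ρm : Config (N + 1) (Fin 3) T3 → T3 → ℝ := fun w x₀ => ∫ q, bx q.1 x₀ ∂(empiricalMeasure w)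
    let mm : Config (N + 1) (Fin 3) T3 → T3 → V3 := fun w x₀ => ∫ q, bx q.1 x₀ • q.2 ∂(empiricalMeasure w)
    let Pm : Config (N + 1) (Fin 3) T3 → T3 → Fin 3 → Fin 3 → ℝ := fun w x₀ j k =>
      (∫ q, bx q.1 x₀ * (q.2 j * q.2 k) ∂(empiricalMeasure w)) - mm w x₀ j * mm w x₀ k / ρm w x₀
    localGibbsLaw σ a₀ u₀ θ₀ N (Φ N)
      {z | η < |∫ s in Set.Icc 0 t, ∫ x, g (σ ^ 3 * ρm ((Φ N).flow s z) x) *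
        ∑ j : Fin 3, ∑ k : Fin 3, a j k (s, x) * Pm ((Φ N).flow s z) x j k|} ≤ ENNReal.ofReal δ

/-- **Collisional pressure value, in band, pre-shock** (sister `CollisionalPressureValueInBand`, verbatim): the normalised
collision functional of the stress mark `g(σ³ρ_r(xᵢ))·|(vᵢ⁻−vⱼ⁻)·ω|·(ω⊗ω : a(s,xᵢ))` minus
`2∫₀ᵗ∫ g(σ³ρ_r)(p_hs(ρ_r,θ_r) − ρ_rθ_r) tr a` tends to `0` in probability.  In THIS route it follows from `EvenStressEnskog` +
`WeakStressIsotropyInBand` by exact algebra — LANDED (`ParityBandClosurePressureValue.stub_pressureValueOfEvenStress`, p136561). -/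
def CollisionalPressureValueInBand : Prop :=
  ∃ η₀ : ℝ, 0 < η₀ ∧ ∀ (a₀ θ₀ : T3 → ℝ) (u₀ : T3 → V3), Continuous a₀ → Continuous θ₀ → Continuous u₀ →
    (∀ x, 0 < a₀ x) → (∀ x, 0 < θ₀ x) → ∃ σ₀ : ℝ, 0 < σ₀ ∧ ∀ σ : ℝ, 0 < σ → σ < σ₀ →
    ∀ (T : ℝ) (ρ θ : ℝ → T3 → ℝ) (u : ℝ → T3 → V3), IsHardSphereEulerSolution σ T ρ u θ →
    ∀ Φ : (N : ℕ) → HardSphereFlow (Torus.geometry (Fin 3)) (hsDiameter σ N) (N + 1),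
    TendstoHydroFieldsAt (fun N => localGibbsLaw σ a₀ u₀ θ₀ N (Φ N)) Φ ρ u θ 0 →
    ∀ t ∈ Set.Ico 0 T, ∀ a : Fin 3 → Fin 3 → ℝ × T3 → ℝ, (∀ j k, Continuous (a j k)) →
    (∀ j k p, a j k p = a k j p) →
    ∀ g : ℝ → ℝ, Continuous g → (∀ b, η₀ ≤ b → g b = 0) →
    ∀ η δ : ℝ, 0 < η → 0 < δ → ∃ r₀ : ℝ, 0 < r₀ ∧ ∀ r : ℝ, 0 < r → r < r₀ → ∃ N₀ : ℕ, ∀ N : ℕ, N₀ ≤ N →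
    let ε := hsDiameter σ N
    let G : Geometry (Fin 3) T3 := Torus.geometry (Fin 3)
    let γ : Config (N + 1) (Fin 3) T3 → ℝ → Config (N + 1) (Fin 3) T3 := fun z s => (Φ N).flow s z
    let bx : T3 → T3 → ℝ := fun y x => 3 / (Real.pi * r ^ 3) * max (1 - Torus.euclidDist y x / r) 0
    let ρm : Config (N + 1) (Fin 3) T3 → T3 → ℝ := fun w x₀ => ∫ q, bx q.1 x₀ ∂(empiricalMeasure w)
    let mm : Config (N + 1) (Fin 3) T3 → T3 → V3 := fun w x₀ => ∫ q, bx q.1 x₀ • q.2 ∂(empiricalMeasure w)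
    let em : Config (N + 1) (Fin 3) T3 → T3 → ℝ := fun w x₀ =>
      ∫ q, bx q.1 x₀ * (‖q.2‖ ^ 2 / 2) ∂(empiricalMeasure w)
    let θm : Config (N + 1) (Fin 3) T3 → T3 → ℝ := fun w x₀ =>
      2 / 3 * (em w x₀ / ρm w x₀ - ‖mm w x₀‖ ^ 2 / (2 * ρm w x₀ ^ 2))
    let pv : Config (N + 1) (Fin 3) T3 → ℝ → Fin (N + 1) → Fin (N + 1) → V3 × V3 := fun z s i j =>
      reflectVel (G.sepVec (γ z s i).1 (γ z s j).1) ((γ z s i).2, (γ z s j).2)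
    let Kc : (Config (N + 1) (Fin 3) T3 → ℝ → Fin (N + 1) → Fin (N + 1) → ℝ) → Config (N + 1) (Fin 3) T3 → ℝ := fun F z =>
      ε / (N + 1 : ℝ) * ∑ᶠ (s : ℝ) (_ : s ∈ collisionTimes G ε (γ z) ∩ Set.Icc 0 t),
        ∑ i : Fin (N + 1), ∑ j : Fin (N + 1),
          (if i ≠ j ∧ ‖G.sepVec (γ z s i).1 (γ z s j).1‖ = ε then F z s i j else 0)
    let D : Config (N + 1) (Fin 3) T3 → ℝ := fun z =>
      Kc (fun z s i j =>
          g (σ ^ 3 * ρm (γ z s) (γ z s i).1) *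
            |⟪(pv z s i j).1 - (pv z s i j).2, ε⁻¹ • G.sepVec (γ z s i).1 (γ z s j).1⟫_ℝ| *
            ∑ k : Fin 3, ∑ l : Fin 3, a k l (s, (γ z s i).1) *
              ((ε⁻¹ • G.sepVec (γ z s i).1 (γ z s j).1) k * (ε⁻¹ • G.sepVec (γ z s i).1 (γ z s j).1) l)) z
        - 2 * ∫ s in Set.Icc 0 t, ∫ x, g (σ ^ 3 * ρm (γ z s) x) *
            (hsPressure σ (ρm (γ z s) x) (θm (γ z s) x) - ρm (γ z s) x * θm (γ z s) x) *
            ∑ k : Fin 3, a k k (s, x)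
    localGibbsLaw σ a₀ u₀ θ₀ N (Φ N) {z | η < |D z|} ≤ ENNReal.ofReal δ

/-- **Mollified fields close in TIME AVERAGE** (sister `MollifiedCloseTimeAveraged`, verbatim): the Grönwall's honest output
and the first hypothesis of the landed weak readout `ChaosClosesEulerReadout.stub_readout` (p119530). -/
def MollifiedCloseTimeAveraged : Prop :=
  ∃ η₀ : ℝ, 0 < η₀ ∧ ∀ (a₀ θ₀ : T3 → ℝ) (u₀ : T3 → V3), Continuous a₀ → Continuous θ₀ → Continuous u₀ →
    (∀ x, 0 < a₀ x) → (∀ x, 0 < θ₀ x) → ∃ σ₀ : ℝ, 0 < σ₀ ∧ ∀ σ : ℝ, 0 < σ → σ < σ₀ →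
    ∀ (T : ℝ) (ρ θ : ℝ → T3 → ℝ) (u : ℝ → T3 → V3), IsHardSphereEulerSolution σ T ρ u θ →
    (∀ t ∈ Set.Ico 0 T, ∀ x, ρ t x * σ ^ 3 < η₀) →
    ∀ Φ : (N : ℕ) → HardSphereFlow (Torus.geometry (Fin 3)) (hsDiameter σ N) (N + 1),
    TendstoHydroFieldsAt (fun N => localGibbsLaw σ a₀ u₀ θ₀ N (Φ N)) Φ ρ u θ 0 →
    ∀ t ∈ Set.Ico 0 T, ∀ Δ : ℝ, 0 < Δ → t + Δ < T → ∀ η δ : ℝ, 0 < η → 0 < δ →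
    ∃ r₀ : ℝ, 0 < r₀ ∧ ∀ r : ℝ, 0 < r → r < r₀ → ∃ N₀ : ℕ, ∀ N : ℕ, N₀ ≤ N →
    let bx : T3 → T3 → ℝ := fun y x => 3 / (Real.pi * r ^ 3) * max (1 - Torus.euclidDist y x / r) 0
    localGibbsLaw σ a₀ u₀ θ₀ N (Φ N)
        {z | η * Δ < ∫ s in Set.Icc t (t + Δ),
          ((∫ x, |empiricalDensityField ((Φ N).flow s z) (fun y => bx y x) - ρ s x|)
          + (∫ x, ‖empiricalMomentumField ((Φ N).flow s z) (fun y => bx y x) - ρ s x • u s x‖)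
          + ∫ x, |empiricalEnergyField ((Φ N).flow s z) (fun y => bx y x) -
              totalEnergyDensity (ρ s x) (u s x) (θ s x)|)} ≤ ENNReal.ofReal δ

/-! ## §1b The line's two NEW typed statements -/

/-- **Inverse-temperature moment of the coarse-grained empirical temperature, pre-shock (the line's ONE new physical input;
NOT in X — `LocalSecondLaw` controls coldness to exponent 1 only).**  Frame VERBATIM `JParityClosure.LocalSecondLaw`
(stmt-13081: profiles, `σ < σ₀`, tied classical hs-Euler solution on `[0,T)`, flows, `0 < T`, horizon `0 < τ < T`; the same
cone mollifier `bx`, fields `ρm, mm, em` and temperature `θm`).  CLAIM: for every `δ` there are an exponent `p > 0`, a budget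
`K` and `r₀` such that for `r < r₀`, `N ≥ N₀(r)`: `P( K < ∫₀^τ∫ ρ_r(s,x) · exp(p · [log(θ(s,x)/θ_r(s,x))]₊) dx ds ) ≤ δ`, i.e.
the `ρ_r`-weighted `p`-th moment of `θ̃/θ_r ∨ 1` is bounded in probability (`N → ∞` then `r → 0`).  This is EXACTLY what the
carving Grönwall of `PlainEntropyShellHS` consumes (module docstring): `B_A ≤ K A² e^{−pA}`; it also bounds `∫∫ρ_r a ≤ K/p`.
Why plausibly true: pre-shock there is no cooling mechanism below the smooth `θ̃`; at rung 0 (global equilibrium, Gibbs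
invariant) cone temperatures are `χ²_{3n−3}`-distributed with `n ≍ N r³ρ ≫ 1` and the moment is `τ(1 + o(1))`; a cold cone of
coldness `a` has Gibbs cost `e^{−(3/2) n a}` against a gain `e^{pa}`.  JUNK (honest): a cone with `≤ 1` particle has `θm = 0`,
`log(θ/0) = log 0 = 0` in Lean, weight `1` — harmless (its mass is `≤ 3/(π r³ (N+1))`); empty cones have `ρm = 0`.  Not a
negatives-index shape: `ρ`-weighted whole-cone temperature (no sub-population parameters as in 6610/6612/9236/9238), `O_P(1)`
currency (no exponential budget as in 14607).  [difficulty: open; sources: FeireislNovotny2012 (conditional WSU needs a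
temperature floor), BrezinaFeireisl2018, Spohn1991] -/
def ColdnessMoment : Prop :=
  ∀ (a₀ θ₀ : Literature.MathematicalPhysics.KineticTheory.T3 → ℝ) (u₀ : Literature.MathematicalPhysics.KineticTheory.T3 → Literature.MathematicalPhysics.KineticTheory.V3), Continuous a₀ → Continuous θ₀ → Continuous u₀ → (∀ x, 0 < a₀ x) → (∀ x, 0 < θ₀ x) → ∃ σ₀ : ℝ, 0 < σ₀ ∧ ∀ σ : ℝ, 0 < σ → σ < σ₀ → ∀ (T : ℝ) (ρ θ : ℝ → Literature.MathematicalPhysics.KineticTheory.T3 → ℝ) (u : ℝ → Literature.MathematicalPhysics.KineticTheory.T3 → Literature.MathematicalPhysics.KineticTheory.V3), Literature.MathematicalPhysics.KineticTheory.IsHardSphereEulerSolution σ T ρ u θ → ∀ Φ : (N : ℕ) → Literature.Analysis.FluidPDE.HardSphereFlow (Literature.Analysis.FluidPDE.Torus.geometry (Fin 3)) (Literature.MathematicalPhysics.KineticTheory.hsDiameter σ N) (N + 1), Literature.MathematicalPhysics.KineticTheory.TendstoHydroFieldsAt (fun N => Literature.MathematicalPhysics.KineticTheory.localGibbsLaw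 σ a₀ u₀ θ₀ N (Φ N)) Φ ρ u θ 0 → 0 < T → ∀ τ : ℝ, 0 < τ → τ < T → ∀ δ : ℝ, 0 < δ → ∃ p : ℝ, 0 < p ∧ ∃ K : ℝ, ∃ r₀ : ℝ, 0 < r₀ ∧ ∀ r : ℝ, 0 < r → r < r₀ → ∃ N₀ : ℕ, ∀ N : ℕ, N₀ ≤ N → let γ : Literature.Analysis.FluidPDE.Config (N + 1) (Fin 3) Literature.MathematicalPhysics.KineticTheory.T3 → ℝ → Literature.Analysis.FluidPDE.Config (N + 1) (Fin 3) Literature.MathematicalPhysics.KineticTheory.T3 := fun z s => (Φ N).flow s z; let bx : Literature.MathematicalPhysics.KineticTheory.T3 → Literature.MathematicalPhysics.KineticTheory.T3 → ℝ := fun x y => 3 / (Real.pi * r ^ 3) * max (1 - Literature.Analysis.FluidPDE.Torus.euclidDist x y / r) 0; let ρm : Literature.Analysis.FluidPDE.Config (N + 1) (Fin 3) Literature.MathematicalPhysics.KineticTheory.T3 → ℝ → Literature.MathematicalPhysics.KineticTheory.T3 → ℝ := fun z s x₀ => ∫ q, bx q.1 x₀ ∂(Literature.Analysis.FluidPDE.empiricalMeasure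 (γ z s)); let mm : Literature.Analysis.FluidPDE.Config (N + 1) (Fin 3) Literature.MathematicalPhysics.KineticTheory.T3 → ℝ → Literature.MathematicalPhysics.KineticTheory.T3 → Literature.MathematicalPhysics.KineticTheory.V3 := fun z s x₀ => ∫ q, bx q.1 x₀ • q.2 ∂(Literature.Analysis.FluidPDE.empiricalMeasure (γ z s)); let em : Literature.Analysis.FluidPDE.Config (N + 1) (Fin 3) Literature.MathematicalPhysics.KineticTheory.T3 → ℝ → Literature.MathematicalPhysics.KineticTheory.T3 → ℝ := fun z s x₀ => ∫ q, bx q.1 x₀ * (‖q.2‖ ^ 2 / 2) ∂(Literature.Analysis.FluidPDE.empiricalMeasure (γ z s)); let θm : Literature.Analysis.FluidPDE.Config (N + 1) (Fin 3) Literature.MathematicalPhysics.KineticTheory.T3 → ℝ → Literature.MathematicalPhysics.KineticTheory.T3 → ℝ := fun z s x₀ => 2 / 3 * (em z s x₀ / ρm z s x₀ - ‖mm z s x₀‖ ^ 2 / (2 * ρm z s x₀ ^ 2)); Literature.MathematicalPhysics.KineticTheory.localGibbsLaw σ a₀ u₀ θ₀ N (Φ N) {z | K < ∫ s in Set.Icc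 (0 : ℝ) τ, ∫ x : Literature.MathematicalPhysics.KineticTheory.T3, ρm z s x * Real.exp (p * max (Real.log (θ s x / θm z s x)) 0)} ≤ ENNReal.ofReal δ

/-- **The Březina–Feireisl a-priori stability shell for FUNCTIONS with the PLAIN (`Z = id`) entropy inequality — hard-sphere
class, coldness-carved (the line's LOAD-BEARING deterministic statement).**  Frame, EOS band extension `(χe, f)`, classical
solution in the band `ρσ³ ≤ η₁/2`, the field `V = (ϱ, m, E)`, the inputs (H1) continuity EXACT against `C¹` tests, (H2)
momentum against `ũ` up to `δ`, (H4) global energy up to `δ`, (H5) sup-closeness `δ` at `τ = 0`, and the window-averaged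
`L¹` conclusion are VERBATIM those of the sister's landed `BF18ShellHS` (`ChaosClosesEulerBF18Shell.stub_bf18Shell`, p136414).
What differs: (H3') is the PLAIN entropy inequality — specific entropy `s = 3/2 log θ − log ϱ − f(ϱ)` with the guard
`0 < ϱ ∧ 0 < θ` else `0` (= the `Hs` convention of `JParityClosure.LocalSecondLaw` 13081), NO clamp, tested against
`θ̃(s,x)·cut_{τ₀}(s)` for every window, the CLASSICAL initial entropy in the boundary term (13081 carries it) — and three
side conditions replace the boundedness the clamp used to give: (H6) COLDNESS BUDGET `∫₀ᵗ∫ ϱ·exp(p[log(θ̃/θ_V)]₊) ≤ K` with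
the exponent `p > 0` and budget `K` quantified BEFORE `ε` (tolerances `Δ₀, δ` may depend on them); (H7) IN-BAND CAP
`ϱσ³ ≤ η₁` everywhere (dense cells `ϱ ≫ ρ̃` are the one far-field class where `ϱ log²(ϱ/ρ̃)` is not Bregman-dominated;
kinetically `DensityCap` + the guard); (H8) FROZEN CELLS ARE THIN: `θ_V ≤ 0 ⇒ ϱ ≤ δ` (with Lean's `log 0 = 0` a suddenly
FROZEN blob of positive density would read as an entropy INCREASE in (H3') and break the conclusion at rung 0 — the same
witness that made the sister shell v7 set `Z := a` there; kinetically `θ_r = 0` iff the cone holds `≤ 1` particle a.s., so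
`ρ_r ≤ 3/(π r³(N+1))`).  PROOF PLAN (adapting ShellMaster/ShellFar/ShellCore*): relative energy = Bregman divergence of
`U ↦ E − θ̃(x)·S(U)` at the classical state (convex for `Z = id` by `HsEntropyConvex`/thermodynamic stability; no clamp
destroys convexity); its increment is bounded by (H1)–(H5) exactly as in BF18 §3; remainders: entropy-transport term
`= Bregman × (∂ₜθ̃ + ũ·∇θ̃)/θ̃` IDENTICALLY; pressure term athermal (`p = ϱ θ_V χe(ϱ)` linear in `(E, |m|²/ϱ)` at fixed `ϱ`,
`monatomicExcess_p_eq_energy`); hot / dilute far field by `energy_entropy_le_of_relEnergyThermo` (BF18 (3.8),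
`BallisticFreeEnergyCoercivity`); dense cells by (H7); frozen cells by (H8) (near-vacuum far field, Bregman `≈ p̃ > 0`); and
the ONLY superlinear remainder, the cross term `∫ϱ(s − s̃)(u − ũ)·∇θ̃` on cold cells `a = log(θ̃/θ_V) ≥ 2`, by
`coldCrossBound`: carve at `A`, `ℰ′ ≤ (C√A + 1)ℰ + C²B_A/4 + err` with `B_A ≤ K A² e^{−pA}` from (H6), choose
`A = A(p, K, ε, t)` then `δ`; discrete Grönwall on `I(τ) = ∫₀^τ ℰ` window by window as in the landed shell.  Deterministic;
no particle system.  [difficulty: XL; sources: BrezinaFeireisl2018 §3, BrezinaFeireisl2018Revisited Def 2.1/Thm 2.5 (the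
`Z = id` class; its "obvious modification" is NOT relied on), FeireislNovotny2012, Dafermos1979] -/
def PlainEntropyShellHS : Prop :=
  ∀ (σ : ℝ), 0 < σ → ∀ (η₁ : ℝ), 0 < η₁ → ∀ (χe f : ℝ → ℝ),
    ContDiffOn ℝ 2 χe (Set.Ioi 0) → ContDiffOn ℝ 2 f (Set.Ioi 0) →
    (∀ a, 0 < a → χe a = 1 + a * deriv f a) → (∀ a, 0 < a → 0 < χe a + a * deriv χe a) →
    (∃ B : ℝ, ∀ a, 0 < a → |χe a| ≤ B) →
    (∀ a, 0 < a → a * σ ^ 3 ≤ η₁ → f a = hsExcessFreeEnergy (a * σ ^ 3) ∧ χe a = hsCompressibility (a * σ ^ 3)) →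
    ∀ (T : ℝ) (ρ θ : ℝ → T3 → ℝ) (u : ℝ → T3 → V3), IsHardSphereEulerSolution σ T ρ u θ →
    (∀ s ∈ Set.Ico 0 T, ∀ x, ρ s x * σ ^ 3 ≤ η₁ / 2) →
    ∀ t ∈ Set.Ioo 0 T, ∀ p : ℝ, 0 < p → ∀ K : ℝ, ∀ ε : ℝ, 0 < ε →
    ∃ Δ₀ : ℝ, 0 < Δ₀ ∧ ∀ Δ : ℝ, 0 < Δ → Δ ≤ Δ₀ → Δ < t →
    ∃ δ : ℝ, 0 < δ ∧ ∀ V : ℝ → T3 → ℝ × V3 × ℝ, Measurable (Function.uncurry V) →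
    (∃ C : ℝ, ∀ s x, |(V s x).1| ≤ C ∧ ‖(V s x).2.1‖ ≤ C ∧ |(V s x).2.2| ≤ C) →
    (∀ s x, 0 ≤ (V s x).1) → (∀ s x, 0 ≤ (V s x).2.2) →
    (∀ s x, ‖(V s x).2.1‖ ^ 2 ≤ 2 * (V s x).1 * (V s x).2.2) →
    (∀ s x, (V s x).1 * σ ^ 3 ≤ η₁) →
    let θo : ℝ × V3 × ℝ → ℝ := fun U => 2 / 3 * (U.2.2 / U.1 - ‖U.2.1‖ ^ 2 / (2 * U.1 ^ 2))
    let pV : ℝ × V3 × ℝ → ℝ := fun U => U.1 * θo U * χe U.1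
    let sV : ℝ × V3 × ℝ → ℝ := fun U =>
      if 0 < U.1 ∧ 0 < θo U then 3 / 2 * Real.log (θo U) - Real.log U.1 - f U.1 else 0
    let Etot : ℝ → T3 → ℝ := fun s x => totalEnergyDensity (ρ s x) (u s x) (θ s x)
    let cut : ℝ → ℝ → ℝ := fun τ₀ s => Real.smoothTransition ((τ₀ + Δ - s) / Δ)
    (∀ φ : ℝ → T3 → ℝ, ContDiff ℝ 1 (Literature.Analysis.FunctionSpaces.Torus.stLift φ) → ∀ τ ∈ Set.Icc 0 t, (∫ x, φ τ x * (V τ x).1) - ∫ x, φ 0 x * (V 0 x).1 = ∫ s in Set.Icc 0 τ, ∫ x, (deriv (fun s' => φ s' x) s * (V s x).1 + ∑ k : Fin 3, (V s x).2.1 k * Literature.Analysis.FunctionSpaces.Torus.partialDeriv k (φ s) x)) →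
    (∀ τ ∈ Set.Icc 0 t, |(∫ x, ⟪u τ x, (V τ x).2.1⟫_ℝ) - (∫ x, ⟪u 0 x, (V 0 x).2.1⟫_ℝ) - ∫ s in Set.Icc 0 τ, ∫ x, (⟪Literature.Analysis.FunctionSpaces.Torus.timeDerivWithin (Set.Ico 0 T) u s x, (V s x).2.1⟫_ℝ + ∑ i : Fin 3, ∑ j : Fin 3, Literature.Analysis.FunctionSpaces.Torus.partialDeriv j (fun y => u s y i) x * ((V s x).2.1 i * (V s x).2.1 j / (V s x).1 + if i = j then pV (V s x) else 0))| ≤ δ) →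
    (∀ τ₀ ∈ Set.Icc 0 (t - Δ), (∫ s in Set.Icc 0 t, ∫ x, ((V s x).1 * sV (V s x) * Literature.Analysis.FunctionSpaces.Torus.timeDerivWithin (Set.Ico 0 T) (fun s' y => θ s' y * cut τ₀ s') s x + sV (V s x) * ⟪(V s x).2.1, Literature.Analysis.FunctionSpaces.Torus.gradient (fun y => θ s y * cut τ₀ s) x⟫_ℝ)) + ∫ x, ρ 0 x * (3 / 2 * Real.log (θ 0 x) - Real.log (ρ 0 x) - f (ρ 0 x)) * (θ 0 x * cut τ₀ 0) ≤ δ) →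
    (∀ τ ∈ Set.Icc 0 t, ∫ x, (V τ x).2.2 ≤ (∫ x, (V 0 x).2.2) + δ) →
    (∀ x, |(V 0 x).1 - ρ 0 x| ≤ δ ∧ ‖(V 0 x).2.1 - ρ 0 x • u 0 x‖ ≤ δ ∧ |(V 0 x).2.2 - Etot 0 x| ≤ δ) →
    ((∫ s in Set.Icc 0 t, ∫ x, (V s x).1 * Real.exp (p * max (Real.log (θ s x / θo (V s x))) 0)) ≤ K) →
    (∀ s x, θo (V s x) ≤ 0 → (V s x).1 ≤ δ) →
    ∀ τ₀ ∈ Set.Icc 0 (t - Δ), ∫ s in Set.Icc τ₀ (τ₀ + Δ), ∫ x, (|(V s x).1 - ρ s x| + ‖(V s x).2.1 - ρ s x • u s x‖ + |(V s x).2.2 - Etot s x|) ≤ ε * Δ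

/-! ## §2 The registered stubs (5) -/

/-- STUB `stub_inputs` (EXTERNAL — not work of this line; a seat handed it answers `stub-blocked` naming the items): the three
open board items the closure consumes, VERBATIM by name — `TwoClocks.EnergyCurrentTails` (stmt-9235: cubic one-body tail;
the readout's windowed energy current at the instant `t` and every UI-of-`|v|²` step of the kinetic half),
`LimitCollisionMeasure.CollisionTightness` (stmt-13354: quartic tightness of the normalised collision measure ⇒
`CollisionMomentUI` by the landed p110597; the route's bare count 13085 is too weak — cards 3/6 of this crux propose the
transfer-weighted substitute), `InformationPercolationEngine.CollisionRate` (stmt-13481: in-band identification of the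
cut-off collision COUNT, the windowed UPPER bounds of the reduction and the readout — `RateFloor` is the lower bound,
`EvenStressEnskog` identifies only transfer-weighted counts).  DELIBERATELY ABSENT: `LimitCollisionMeasure.LocalSecondLaw`
(stmt-13352, the clamped law) — replaced by the route's own 13081 + `ColdnessMoment`. -/
theorem stub_inputs :
    TwoClocks.EnergyCurrentTails ∧ LimitCollisionMeasure.CollisionTightness ∧ InformationPercolationEngine.CollisionRate := by
  sorry

/-- STUB `stub_kineticHalf` (INPUT LAYER, typed over the route's decl NAMES; NOT this line's work and DEAD AS TYPED:
`Lines/SketchDead.md` + the kernel-checked two-fibre counter-model `ParityBandClosureNegative.youngMixing_twoFibre_counterModel`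
p141493 show that `OddContactSymmetry` (17722) and `RateFloor` (13080) with FIXED marks / fixed `χ` deliver only
Young-fibre-AVERAGED limit identities, which force neither fibrewise detailed balance nor fibrewise thickness.  The tenure
planner's restatement R-a (jump-marked odd marks `Ψ(n̂,v,w,F)`, measure-level consumer LANDED p141247) / R-b (rate floor
window-by-window at scale `r`) is a `--restate` that KEEPS the decl names, after which THIS TEXT is the live kinetic item
verbatim (its measure-level chain is landed: p139072 → p138663/p141247 → p139366 → p137939 ∘ `parityRigidity_proof` ∘ p137300;
what it owes is the Young-measure extraction with `r`-independent tolerances; convergent docking level = pointwise local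
equilibrium, sister v11 `stub_stressIsotropyOfLocalEquilibrium`).  Statement: the parity mechanism with the cut-offs kept
inactive by `DensityCap`, the cubic tail (9235) and the quartic collision tightness (13354) yields weak stress isotropy in
band, `WeakStressIsotropyInBand` verbatim.  Until the restatement a seat handed this stub answers `stub-blocked: awaiting
R-a/R-b restatement of 17722/13080 (SketchDead §5)`. -/
theorem stub_kineticHalf :
    JParityClosure.OddContactSymmetry → JParityClosure.RateFloor → JParityClosure.DensityCap →
    TwoClocks.EnergyCurrentTails → LimitCollisionMeasure.CollisionTightness → WeakStressIsotropyInBand := by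
  sorry

/-- STUB `stub_coldnessMoment` (OWN, the line's one new physical input, L–XL; body VERBATIM `ColdnessMoment`): the
`ρ_r`-weighted `p`-th inverse-temperature moment of the cone temperature against the classical one is bounded in
probability before the shock.  Rung 0 (global equilibrium) is an honest first target: Gibbs invariance (p72343) + cone-count
concentration + `χ²` lower tails; see the def's docstring for the junk conventions.  Cheapest falsifier: none cheaper than
rung 0 (the statement is in probability, `N → ∞` at fixed `r`, whole-cone temperature). -/
theorem stub_coldnessMoment : ColdnessMoment := by
  sorry

/-- STUB `stub_plainEntropyShell` (OWN, LOAD-BEARING, XL, deterministic; body VERBATIM `PlainEntropyShellHS`): the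
Březina–Feireisl relative-energy shell for functions with the PLAIN entropy inequality, coldness-carved by `coldCrossBound`.
Hardest stub of the line; the landed clamped shell (p136414, ShellMaster/ShellFar/ShellCore*/… 20 helpers) is the template —
the clamp is removed, (H6)/(H7)/(H8) pay for what it bought (see the def's docstring for the remainder-by-remainder plan). -/
theorem stub_plainEntropyShell : PlainEntropyShellHS := by
  sorry

/-- STUB `stub_plainKineticReduction` (OWN, XL− bookkeeping; template = the landed `ChaosClosesEulerKineticReduction.stub_kineticReduction`
p138091 and its Reduction* pyramid, of which (H1) `MassBalanceC1` p133127, (H2) via `EmpiricalWeakEquation` p108039 + WSI + CPV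
+ `CollisionMomentUI` + `CollisionRate`, (H4) exact energy conservation, (H5) `InitialLayer` p97752, the finite `τ₀`-grid and
the pathwise time-modulus transfer UNCHANGED).  NEW obligations, all on the intersection of finitely many good events with
tolerances fixed before `r`: (H3') from the PLAIN `JParityClosure.LocalSecondLaw` (13081) — its functional is
`∫∫ Hs(ρm,θm)(∂ₛφ + (mm/ρm)·∇φ) + ∫ Hs(ρ̃₀,θ̃₀)φ₀ ≥ −η` with `Hs = −ϱ s` under the SAME guard as the shell's `sV`, so (H3')
is 13081 with `φ = ` a globally smooth approximant of `θ̃(s+ε′,x)·cut_{τ₀}(s)` (shift/extend across `s = 0`, 13081 wants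
`IsSmoothSpaceTimeOn univ`, `φ ≥ 0`, `φ = 0` after `τ₀ + Δ < τ`); the approximation error is `‖φ − θ̃cut‖_{C¹} · ∫∫|S_r|`
and `∫∫|S_r| ≤ C(K/p + Ē t + 1)` on the `ColdnessMoment` ∩ `DensityCap` events (`ρ a ≤ ρ e^{pa}/p` cold, `ρ log θ ≤ ρθ`
hot, `ρ|log ρ|` capped), and `f = hsExcessFreeEnergy(·σ³)` on the cap event; (H6) IS the `ColdnessMoment` event (same `γ, bx,
ρm, θm`; `θ̃ > 0` on `[0,t]`); (H7) from the `DensityCap` event at `t_shell < T` plus the guard `ρ̃σ³ < η₀ ≤ η₁/2` and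
`η ≤ η₁/(2σ³)`; (H8) `θm = 0 ⇒` the cone holds `≤ 1` particle (velocity coincidences are null under the local Gibbs law
and not created by the flow on `Φ.good` — cf. the sister's `ReductionCoincidence`/`ReductionCold`) `⇒ ρm ≤ 3/(π r³(N+1)) ≤ δ`
for `N ≥ N₀(r, δ)`.  Order: `(t, Δ, η, δ) → (p, K)` from `ColdnessMoment` at `δ/8` → shell `(Δ₀, δ_sh)` at `(p, K, ε := η/8)`
→ grids/bumps → per-input `(η′, δ′)` → `r₀ := min` → `r` → `N₀ := max`.  Output `MollifiedCloseTimeAveraged` with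
`η₀ := min(η₁/2, η₀ᵂˢᴵ, η₀ᶜᴾⱽ, η₀ᶜᴿ)`. -/
theorem stub_plainKineticReduction :
    WeakStressIsotropyInBand → CollisionalPressureValueInBand → CollisionMomentUI →
    InformationPercolationEngine.CollisionRate → JParityClosure.LocalSecondLaw → JParityClosure.DensityCap →
    ColdnessMoment → PlainEntropyShellHS → MollifiedCloseTimeAveraged := by
  sorry

/-! ## §3 The composition (pure logic, no `sorry`) -/

/-- **The line closes the crux modulo its stubs.**  ALL FIVE hypotheses are consumed: `hO`, `hR` (kinetic half), `hE`
(pressure value, landed p136561), `hL` — the PLAIN local second law 13081 — and `hD` (reduction + readout, re-addressed as the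
syntactically identical `InformationPercolationEngine.DensityCap`).  Readout = the LANDED `ChaosClosesEulerReadout.stub_readout`
(p119530) fed with the landed exact identity 13356 (p107599). -/
theorem ParityBandClosure_of : JParityClosure.ParityBandClosure := fun hO hE hR hL hD =>
  have hIn := stub_inputs
  have hT : TwoClocks.EnergyCurrentTails := hIn.1
  have hCT : LimitCollisionMeasure.CollisionTightness := hIn.2.1
  have hCR : InformationPercolationEngine.CollisionRate := hIn.2.2
  have hD' : InformationPercolationEngine.DensityCap := hD
  have hUI : CollisionMomentUI :=
    Summit.AtomisticToContinuum.HydrodynamicLimit.Theorems.ChaosClosesEulerCollisionMomentUI.stub_collisionMomentUI hCT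
  have hW : WeakStressIsotropyInBand := stub_kineticHalf hO hR hD hT hCT
  have hP : CollisionalPressureValueInBand :=
    Summit.AtomisticToContinuum.HydrodynamicLimit.Theorems.ParityBandClosurePressureValue.stub_pressureValueOfEvenStress hE hW
  have hM : MollifiedCloseTimeAveraged :=
    stub_plainKineticReduction hW hP hUI hCR hL hD stub_coldnessMoment stub_plainEntropyShell
  Summit.AtomisticToContinuum.HydrodynamicLimit.Theorems.ChaosClosesEulerReadout.stub_readout hM
    Summit.AtomisticToContinuum.HydrodynamicLimit.Theorems.ChaosClosesEulerEnskogIdentity.stub_empiricalEnskogIdentity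
    hT hUI hCR hD'

end Summit.AtomisticToContinuum.HydrodynamicLimit.Cruxes.ParityBandClosure.PlainEntropyFiniteNBf

end
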